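import Literature.Algebra.Lie.ChevalleyEilenbergCasimirHomotopy
import HarnessLib

/-!
# A `𝔨`-equivariant homotopy over a `K`-invariant tensor preserves the `(𝔤, K)`-complex —
crux HeckeEigenvalueField (stmt-Langlands-13632), line Sketch, stub TUPLE-K

Statement.  Let `K ≤ L` be a Lie subalgebra (`𝔨 ≤ 𝔤`), `A` a compatible action of a group `Γ`
on `(L, M)` (`PairAction`), `σ' : L → End_R M` linear and `x : ι → L` a finite family.  Assume
* `σ'` is `𝔨`-equivariant: `[ρ(y), σ'(u)] = σ'([y, u])` for `y ∈ K`, `u ∈ L`;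
* the tensor `∑_b x_b ⊗ x_b` is `𝔨`-invariant: `∑_b [y, x_b] ⊗ x_b + x_b ⊗ [y, x_b] = 0`, `y ∈ K`;
* `σ'` is `Γ`-equivariant: `τ(g) σ'(u) = σ'(σ_g u) τ(g)`;
* the tensor is `Γ`-invariant: `∑_b σ_g x_b ⊗ σ_g x_b = ∑_b x_b ⊗ x_b`.
Then the Casimir homotopy `h f = ∑_b σ'(x_b) ∘ i_{x_b} f` maps `C^{q+1}(𝔤, 𝔨, K; M)` to
`C^q(𝔤, 𝔨, K; M)` [cite: BorelWallach2000, I §5.1 and II §2.2–2.3] (this is what the formal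
adjoint `D* = ∑_b L†_{x_b} ∘ i_{x_b}` of the relative differential satisfies: only `𝔨`- and
`K`-equivariance, not `𝔤`-equivariance).

Proof.  The tree's `casimirHomotopy_mem_gK` VERBATIM, observing that its proof of
`θ_y h = h θ_y` (`lieDer_casimirHomotopy`) uses the equivariance of `σ'` and the invariance of the
tensor only at the fixed `y`: `θ_y (σ'(u) ∘ i_v f) = σ'(u) ∘ θ_y i_v f + [ρ(y), σ'(u)] ∘ i_v f`
(`lieDer_post`), `θ_y i_v = i_v θ_y + i_{[y,v]}` (Cartan), and the two defect terms
`σ'([y, x_b]) ∘ i_{x_b} f + σ'(x_b) ∘ i_{[y, x_b]} f` sum to zero by the invariance of the tensor under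
`y` (`sum_bilin_eq_zero_of_tensor`).  Relativity for `y ∈ 𝔨` then follows from `θ_y f = 0`,
`i_y f = 0` and `i_y h = -h i_y` (`ins_casimirHomotopy`); `K`-fixedness is `act_casimirHomotopy`.

## References

* A. Borel, N. Wallach, *Continuous cohomology, discrete subgroups, and representations of
  reductive groups*, 2nd ed., Math. Surveys Monogr. 67 (2000), I §1.2, I §5.1, II §2.2–2.3.
  [BorelWallach2000]
* C. Chevalley, S. Eilenberg, *Cohomology theory of Lie groups and Lie algebras*, Trans. Amer.
  Math. Soc. 63 (1948) 85–124, §23–§24. [ChevalleyEilenberg1948]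
-/

set_option linter.dupNamespace false -- project-wide: `Summit.Langlands.Langlands` is the mandated namespace

open Literature.Algebra.Lie Literature.Algebra.Lie.ChevalleyEilenberg
open scoped TensorProduct

namespace Summit.Langlands.Langlands.Theorems.HeckeEigenvalueField.Res

namespace TupleK

/-- **The Lie derivative `θ_x` commutes with the Casimir homotopy** as soon as `σ` is
equivariant under the single element `x` (`[ρ(x), σ(u)] = σ([x, u])` for all `u`) and the tensor
`∑_s y_s ⊗ y'_s` is invariant under `x` (the tree's `lieDer_casimirHomotopy` with its
equivariance hypothesis restricted to the fixed `x`, same proof).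
[cite: ChevalleyEilenberg1948, §24] -/
theorem lieDer_casimirHomotopy_of_pointwise
    {R : Type*} [CommRing R] {L : Type*} [LieRing L] [LieAlgebra R L]
    {M : Type*} [AddCommGroup M] [Module R M] [LieRingModule L M] [LieModule R L M]
    {ι : Type*} [Fintype ι] {σ : L →ₗ[R] Module.End R M} {y y' : ι → L} {x : L}
    (hσx : ∀ u : L, LieModule.toEnd R L M x * σ u - σ u * LieModule.toEnd R L M x = σ ⁅x, u⁆)
    (hT : ∑ s, (⁅x, y s⁆ ⊗ₜ[R] y' s + y s ⊗ₜ[R] ⁅x, y' s⁆) = (0 : L ⊗[R] L))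
    (q : ℕ) (f : Cochain R L M (q + 1)) :
    lieDer R L M q x (casimirHomotopy σ y y' q f) =
      casimirHomotopy σ y y' q (lieDer R L M (q + 1) x f) := by
  have hins : ∀ s, lieDer R L M q x (ins q (y' s) f) =
      ins q (y' s) (lieDer R L M (q + 1) x f) + ins q ⁅x, y' s⁆ f := fun s => by
    rw [ins_lieDer, sub_add_cancel]
  have key := sum_bilin_eq_zero_of_tensor (postInsBilin (σ := σ) q f) hT
  simp only [postInsBilin_apply] at key
  simp only [casimirHomotopy_apply, map_sum, lieDer_post, hσx, hins, map_add]
  rw [← sub_eq_zero, ← Finset.sum_sub_distrib, ← key]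
  refine Finset.sum_congr rfl fun s _ => ?_
  abel

/-- **The Casimir homotopy preserves the relative complex of `K`** when `σ` is `K`-equivariant
and the tensor `∑_s y_s ⊗ y'_s` is `K`-invariant (the tree's `casimirHomotopy_mem_rel` with
hypotheses restricted to `K`: `θ_y h f = h θ_y f = 0` and `i_y h f = -h i_y f = 0` for `y ∈ K`).
[cite: BorelWallach2000, I §1.2] -/
theorem casimirHomotopy_mem_rel_of_subalgebra
    {R : Type*} [CommRing R] {L : Type*} [LieRing L] [LieAlgebra R L]
    {M : Type*} [AddCommGroup M] [Module R M] [LieRingModule L M] [LieModule R L M]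
    (K : LieSubalgebra R L) {ι : Type*} [Fintype ι] {σ : L →ₗ[R] Module.End R M} {y y' : ι → L}
    (hσ : ∀ x ∈ K, ∀ u : L, LieModule.toEnd R L M x * σ u - σ u * LieModule.toEnd R L M x = σ ⁅x, u⁆)
    (hT : ∀ x ∈ K, ∑ s, (⁅x, y s⁆ ⊗ₜ[R] y' s + y s ⊗ₜ[R] ⁅x, y' s⁆) = (0 : L ⊗[R] L))
    (q : ℕ) (f : Cochain R L M (q + 1)) (hf : f ∈ (Subcomplex.rel R L M K).carrier (q + 1)) :
    casimirHomotopy σ y y' q f ∈ (Subcomplex.rel R L M K).carrier q := by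
  rw [Subcomplex.mem_rel_succ_iff] at hf
  cases q with
  | zero =>
    rw [Subcomplex.mem_rel_zero_iff]
    intro x hx
    rw [lieDer_casimirHomotopy_of_pointwise (hσ x hx) (hT x hx), (hf x hx).1, map_zero]
  | succ q =>
    rw [Subcomplex.mem_rel_succ_iff]
    intro x hx
    refine ⟨?_, ?_⟩
    · rw [lieDer_casimirHomotopy_of_pointwise (hσ x hx) (hT x hx), (hf x hx).1, map_zero]
    · rw [ins_casimirHomotopy, (hf x hx).2, map_zero, neg_zero]

end TupleK

/-- **Stub TUPLE-K — a `𝔨`-equivariant homotopy over a `K`-invariant tensor of `𝔭` preserves the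
`(𝔤, K)`-complex** (the variant of the tree's `casimirHomotopy_mem_gK` in which the equivariance of
`σ'` and the invariance of `∑_b x_b ⊗ x_b` are only required for `𝔨` and `K` — what the formal adjoint
`D* = ∑_b L†_{x_b} ∘ i_{x_b}` of the relative complex satisfies: `L†` is `𝔨`- and `K`-equivariant because the
inner products are `K`-invariant, and an orthonormal basis of `𝔭` for an `Ad K`-invariant form has an
invariant tensor).  Same proofs as `lieDer_casimirHomotopy`, `casimirHomotopy_mem_rel`,
`act_casimirHomotopy`, restricted to `y ∈ 𝔨`, `g ∈ K`. [cite: BorelWallach2000, I §5.1 and II §2.2–2.3] -/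
theorem stub_casimirHomotopy_mem_gK_of_compact
    {R : Type} [CommRing R] {L : Type} [LieRing L] [LieAlgebra R L]
    {M : Type} [AddCommGroup M] [Module R M] [LieRingModule L M] [LieModule R L M]
    (K : LieSubalgebra R L) {Γ : Type} [Group Γ] (A : PairAction R L M Γ)
    {ι : Type} [Fintype ι] (σ' : L →ₗ[R] Module.End R M) (x : ι → L)
    (hσ𝔨 : ∀ y ∈ K, ∀ u : L, LieModule.toEnd R L M y * σ' u - σ' u * LieModule.toEnd R L M y = σ' ⁅y, u⁆)
    (hT𝔨 : ∀ y ∈ K, ∑ b, (⁅y, x b⁆ ⊗ₜ[R] x b + x b ⊗ₜ[R] ⁅y, x b⁆) = (0 : L ⊗[R] L))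
    (hσK : ∀ (g : Γ) (u : L), A.τ g ∘ₗ σ' u = σ' (A.σ g u) ∘ₗ A.τ g)
    (hTK : ∀ g : Γ, ∑ b, A.σ g (x b) ⊗ₜ[R] A.σ g (x b) = ∑ b, x b ⊗ₜ[R] x b)
    (q : ℕ) (f : Cochain R L M (q + 1)) (hf : f ∈ (Subcomplex.gK R L M K A).carrier (q + 1)) :
    casimirHomotopy σ' x x q f ∈ (Subcomplex.gK R L M K A).carrier q := by
  rw [Subcomplex.mem_gK_iff] at hf ⊢
  exact ⟨TupleK.casimirHomotopy_mem_rel_of_subalgebra K hσ𝔨 hT𝔨 q f hf.1, fun g => by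
    rw [act_casimirHomotopy A hσK (hTK g), hf.2 g]⟩

end Summit.Langlands.Langlands.Theorems.HeckeEigenvalueField.Res
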